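import Mathlib

/-!
# The landing cubic of the near-miss fold — kernel #108 (solo-blind, s59)

Paper §24.59(5) (window lemma) and §24.60 (F-series).  Near the neutral leaf `xₑ` of the
designed dimple the outer pattern intensity has the normal form
`q(s) = κ s⁴/24 + ε₂ s²/2 + ε₁ s + ε₀`, `s = x - xₑ`, `κ = S₁/(A|b|) > 0`,
where `(ε₁, ε₂)` are the defects of the two landing conditions that the two running dials
`(K₀, θ)` control (the contact `x₀` absorbs `ε₀`).  A finite-`n` solution lands at a
critical point `d` of `q` (`q'(d) = κ d³/6 + ε₂ d + ε₁ = 0`, a double root of `q`) and the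
mean-flow jump behind the landing is proportional to the curvature there,
`J := q''(d) = κ d²/2 + ε₂`.

Eliminating `d` gives the **landing cubic** (`landing_cubic`)

  `2 (J - ε₂) (J + 2 ε₂)² = 9 κ ε₁²`,

from which the near-miss laws measured in §24.60(5) follow exactly:

* `jump_axis_eps1` — on the axis `ε₂ = 0`: `2 J³ = 9 κ ε₁²`, i.e. `J ∝ |ε₁|^{2/3}`
  (the `2/3` law of the `K₀`-offsets), and `J ≥ 0` (`jump_nonneg_of_eps2_nonpos`);
* `jump_axis_eps2` — on the axis `ε₁ = 0`: `J = ε₂` or `J = -2 ε₂`, i.e. `J ∝ |ε₂|¹` with the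
  factor-two asymmetry between the two signs of the phase offset (the landing beyond `xₑ`,
  `d ≠ 0`, forces `J = -2 ε₂`, `jump_axis_eps2_of_ne`);
* `jump_eq_zero` — a jump-free landing (`J = 0`) forces `8 ε₂³ + 9 κ ε₁² = 0`: off this
  semicubical curve every landing carries a jump (`jump_ne_zero`), and in the closed half-plane
  `ε₂ ≥ 0` (`κ > 0`) only the design point `ε₁ = ε₂ = 0` is jump-free
  (`jump_free_only_at_design`);
* `near_miss_lower_bound` — in general `(|J| + 2|ε₂|)³ ≥ (9/2) κ ε₁²`: the jump cannot be
  small unless BOTH defects are (the quantitative content of 'codimension two').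

Pure real algebra over `Mathlib`; no `sorry`.
-/

namespace Summit.AnomalousDissipation.AnomalousDissipation.Theorems

/-- The jump (curvature at the landing point) of the normal form. -/
noncomputable def landingJump (κ ε₂ d : ℝ) : ℝ := κ * d ^ 2 / 2 + ε₂

/-- **Landing cubic.** If `d` is a critical point of the landing normal form,
`κ d³/6 + ε₂ d + ε₁ = 0`, then the jump `J = κ d²/2 + ε₂` satisfies
`2 (J - ε₂) (J + 2ε₂)² = 9 κ ε₁²`. -/
theorem landing_cubic (κ ε₁ ε₂ d : ℝ) (hd : κ * d ^ 3 / 6 + ε₂ * d + ε₁ = 0) :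
    2 * (landingJump κ ε₂ d - ε₂) * (landingJump κ ε₂ d + 2 * ε₂) ^ 2 = 9 * κ * ε₁ ^ 2 := by
  have h1 : ε₁ = -(κ * d ^ 3 / 6 + ε₂ * d) := by linarith
  subst h1
  unfold landingJump
  ring

/-- The `2/3` law: on the axis `ε₂ = 0` the jump obeys `2 J³ = 9 κ ε₁²`. -/
theorem jump_axis_eps1 (κ ε₁ d : ℝ) (hd : κ * d ^ 3 / 6 + ε₁ = 0) :
    2 * landingJump κ 0 d ^ 3 = 9 * κ * ε₁ ^ 2 := by
  have h := landing_cubic κ ε₁ 0 d (by simpa using hd)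
  simp only [sub_zero, mul_zero, add_zero] at h
  calc 2 * landingJump κ 0 d ^ 3 = 2 * (landingJump κ 0 d) * (landingJump κ 0 d) ^ 2 := by ring
    _ = 9 * κ * ε₁ ^ 2 := h

/-- `J - ε₂ = κ d²/2 ≥ 0` whenever `κ ≥ 0`: the landing curvature never falls below the
curvature defect (no undershoot branch). -/
theorem jump_sub_eps2_nonneg (κ ε₂ d : ℝ) (hκ : 0 ≤ κ) : 0 ≤ landingJump κ ε₂ d - ε₂ := by
  unfold landingJump
  have : 0 ≤ κ * d ^ 2 / 2 := by positivity
  linarith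

/-- On the axis `ε₂ = 0` with `κ ≥ 0` the jump is nonnegative (the envelope overshoots on both
sides of the design point; there is no undershoot branch). -/
theorem jump_nonneg_of_eps2_zero (κ d : ℝ) (hκ : 0 ≤ κ) : 0 ≤ landingJump κ 0 d := by
  simpa using jump_sub_eps2_nonneg κ 0 d hκ

/-- The exponent-`1` law with its factor-two asymmetry: on the axis `ε₁ = 0` (and `κ ≠ 0`)
a critical point has jump `J = ε₂` (landing at `xₑ`, `d = 0`) or `J = -2 ε₂`
(landing beyond `xₑ`, `κ d² = -6 ε₂`). -/
theorem jump_axis_eps2 (κ ε₂ d : ℝ) (hd : κ * d ^ 3 / 6 + ε₂ * d = 0) :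
    landingJump κ ε₂ d = ε₂ ∨ landingJump κ ε₂ d = -2 * ε₂ := by
  have hfac : d * (κ * d ^ 2 / 6 + ε₂) = 0 := by
    have : d * (κ * d ^ 2 / 6 + ε₂) = κ * d ^ 3 / 6 + ε₂ * d := by ring
    rw [this]; exact hd
  rcases mul_eq_zero.mp hfac with h0 | h0
  · left; unfold landingJump; rw [h0]; ring
  · right; unfold landingJump
    have : κ * d ^ 2 / 2 = -3 * ε₂ := by linarith
    linarith

/-- The displaced landing (`d ≠ 0`) on the axis `ε₁ = 0` has jump exactly `-2 ε₂`. -/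
theorem jump_axis_eps2_of_ne (κ ε₂ d : ℝ) (hd : κ * d ^ 3 / 6 + ε₂ * d = 0) (hne : d ≠ 0) :
    landingJump κ ε₂ d = -2 * ε₂ := by
  have hfac : d * (κ * d ^ 2 / 6 + ε₂) = 0 := by
    have : d * (κ * d ^ 2 / 6 + ε₂) = κ * d ^ 3 / 6 + ε₂ * d := by ring
    rw [this]; exact hd
  rcases mul_eq_zero.mp hfac with h0 | h0
  · exact absurd h0 hne
  · unfold landingJump
    have : κ * d ^ 2 / 2 = -3 * ε₂ := by linarith
    linarith

/-- A jump-free landing lies on the semicubical curve `8 ε₂³ + 9 κ ε₁² = 0`. -/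
theorem jump_eq_zero (κ ε₁ ε₂ d : ℝ) (hd : κ * d ^ 3 / 6 + ε₂ * d + ε₁ = 0)
    (hJ : landingJump κ ε₂ d = 0) : 8 * ε₂ ^ 3 + 9 * κ * ε₁ ^ 2 = 0 := by
  have h := landing_cubic κ ε₁ ε₂ d hd
  rw [hJ] at h
  linear_combination (-1 : ℝ) * h

/-- Off the semicubical curve every landing carries a non-zero jump. -/
theorem jump_ne_zero (κ ε₁ ε₂ d : ℝ) (hd : κ * d ^ 3 / 6 + ε₂ * d + ε₁ = 0)
    (hoff : 8 * ε₂ ^ 3 + 9 * κ * ε₁ ^ 2 ≠ 0) : landingJump κ ε₂ d ≠ 0 :=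
  fun hJ => hoff (jump_eq_zero κ ε₁ ε₂ d hd hJ)

/-- In the closed half-plane `ε₂ ≥ 0` with `κ > 0` the only jump-free landing is the design
point `ε₁ = ε₂ = 0` (there `8 ε₂³ + 9 κ ε₁² = 0` forces both to vanish). -/
theorem jump_free_only_at_design (κ ε₁ ε₂ d : ℝ) (hκ : 0 < κ) (hε₂ : 0 ≤ ε₂)
    (hd : κ * d ^ 3 / 6 + ε₂ * d + ε₁ = 0) (hJ : landingJump κ ε₂ d = 0) :
    ε₁ = 0 ∧ ε₂ = 0 := by
  have h := jump_eq_zero κ ε₁ ε₂ d hd hJ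
  have h2 : 0 ≤ 8 * ε₂ ^ 3 := by positivity
  have h1 : 0 ≤ 9 * κ * ε₁ ^ 2 := by positivity
  have h1z : 9 * κ * ε₁ ^ 2 = 0 := by linarith
  have h2z : 8 * ε₂ ^ 3 = 0 := by linarith
  have hε₁ : ε₁ = 0 := by
    have : ε₁ ^ 2 = 0 := by
      have hk : (9 * κ) ≠ 0 := by positivity
      have : 9 * κ * ε₁ ^ 2 = (9 * κ) * ε₁ ^ 2 := by ring
      rw [this] at h1z
      exact (mul_eq_zero.mp h1z).resolve_left hk
    exact pow_eq_zero_iff (n := 2) (by norm_num) |>.mp this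
  have hε₂' : ε₂ = 0 := by
    have : ε₂ ^ 3 = 0 := by
      have : 8 * ε₂ ^ 3 = (8 : ℝ) * ε₂ ^ 3 := rfl
      exact (mul_eq_zero.mp h2z).resolve_left (by norm_num)
    exact pow_eq_zero_iff (n := 3) (by norm_num) |>.mp this
  exact ⟨hε₁, hε₂'⟩

/-- **Near-miss lower bound** (`κ ≥ 0`): `(|J| + 2|ε₂|)³ ≥ (9/2) κ ε₁²`.  The jump can only be
small if both landing defects are small — the quantitative form of 'the jump-free landing has
codimension two', with the `2/3` exponent in `ε₁` and the exponent `1` in `ε₂`. -/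
theorem near_miss_lower_bound (κ ε₁ ε₂ d : ℝ) (hκ : 0 ≤ κ)
    (hd : κ * d ^ 3 / 6 + ε₂ * d + ε₁ = 0) :
    9 / 2 * κ * ε₁ ^ 2 ≤ (|landingJump κ ε₂ d| + 2 * |ε₂|) ^ 3 := by
  set J := landingJump κ ε₂ d with hJdef
  have hc := landing_cubic κ ε₁ ε₂ d hd
  rw [← hJdef] at hc
  -- X := |J| + 2|ε₂| dominates both factors
  have hX0 : 0 ≤ |J| + 2 * |ε₂| := by positivity
  have hA0 : 0 ≤ J - ε₂ := by rw [hJdef]; exact jump_sub_eps2_nonneg κ ε₂ d hκ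
  have hA : J - ε₂ ≤ |J| + 2 * |ε₂| := by
    have h1 : J ≤ |J| := le_abs_self J
    have h2 : -ε₂ ≤ |ε₂| := neg_le_abs ε₂
    have h3 : 0 ≤ |ε₂| := abs_nonneg ε₂
    linarith
  have hB : |J + 2 * ε₂| ≤ |J| + 2 * |ε₂| := by
    calc |J + 2 * ε₂| ≤ |J| + |2 * ε₂| := abs_add_le _ _
      _ = |J| + 2 * |ε₂| := by rw [abs_mul]; norm_num
  have hB2 : (J + 2 * ε₂) ^ 2 ≤ (|J| + 2 * |ε₂|) ^ 2 := by
    have h1 := sq_abs (J + 2 * ε₂)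
    have h2 : 0 ≤ |J + 2 * ε₂| := abs_nonneg _
    nlinarith [mul_le_mul hB hB h2 hX0]
  have hsq0 : 0 ≤ (J + 2 * ε₂) ^ 2 := sq_nonneg _
  have key : 2 * (J - ε₂) * (J + 2 * ε₂) ^ 2 ≤ 2 * (|J| + 2 * |ε₂|) * (|J| + 2 * |ε₂|) ^ 2 := by
    have s1 : 2 * (J - ε₂) * (J + 2 * ε₂) ^ 2 ≤ 2 * (|J| + 2 * |ε₂|) * (J + 2 * ε₂) ^ 2 := by
      have := mul_le_mul_of_nonneg_right hA hsq0
      linarith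
    have s2 : 2 * (|J| + 2 * |ε₂|) * (J + 2 * ε₂) ^ 2 ≤ 2 * (|J| + 2 * |ε₂|) * (|J| + 2 * |ε₂|) ^ 2 := by
      have := mul_le_mul_of_nonneg_left hB2 hX0
      linarith
    exact le_trans s1 s2
  have : 2 * (|J| + 2 * |ε₂|) * (|J| + 2 * |ε₂|) ^ 2 = 2 * (|J| + 2 * |ε₂|) ^ 3 := by ring
  rw [this, hc] at key
  linarith

/-- The `2/3` law as a two-sided statement on the axis `ε₂ = 0`, `κ ≥ 0`:
`J ≥ 0` and `J³ = (9/2) κ ε₁²`. -/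
theorem two_thirds_law (κ ε₁ d : ℝ) (hκ : 0 ≤ κ) (hd : κ * d ^ 3 / 6 + ε₁ = 0) :
    0 ≤ landingJump κ 0 d ∧ landingJump κ 0 d ^ 3 = 9 / 2 * κ * ε₁ ^ 2 := by
  refine ⟨jump_nonneg_of_eps2_zero κ d hκ, ?_⟩
  have h := jump_axis_eps1 κ ε₁ d hd
  linarith

end Summit.AnomalousDissipation.AnomalousDissipation.Theorems
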